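import Mathlib
import Summits.Ventures.FusionMHD.Models.CerfonFreidbergNstxLikeQHalfData
import Literature.MathematicalPhysics.MHD.CerfonFreidbergAlphaZeroDerivatives
import Summits.Ventures.FusionMHD.Models.FluxSurfacePolarRayLoop
import HarnessLib

/-!
# Ventures/FusionMHD — Models/CerfonFreidbergNstxLikeQHalf.lean: ★ THE CERTIFIED INTERIOR SAFETY FACTOR `q(ψ_N = 1/2)/F` OF THE
# Cerfon–Freidberg NSTX-like INSTANCE — `2.247991161 ≤ q/F ≤ 2.247991192` (polar `(6.35)` form), assembled from 32 kernel-checked panels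
# (NSTX-like TWIN of ★ #117 `Models/CerfonFreidbergIterLikeQHalf.lean`)

HONEST FRAMING (LADDER-GRIDFUSION three columns; CF rung; F2 item R2 «q on an interior surface of a shaped, NON-POLYNOMIAL equilibrium»,
`pub/gridfusion/models/F2-SCOPING.md` v1.5 §9(d): the NSTX-like twin — the same lane on the low-aspect-ratio, strongly shaped triple
`(ε, κ, δ) = (39/50, 2, 7/20)`).
* CERTIFIED (kernel, this file + its imports; axioms standard): for THE flux of record `U = cfSolution 0 coeff` of the CF NSTX-like instance
  (`Models/CerfonFreidbergNstxLikeAxisCert`), on the level `u₀ = U(X_a,0)/2` (`ψ_N = 1/2`): along EVERY polar ray from the magnetic axis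
  `(X_a, 0)` with angle `θ ∈ [0, π]` the flux first reaches the level at a unique radius `ρ(θ) ∈ (0.37, 0.98)` (model-7's glued `rayRadius`,
  continuous in `θ`, inside a tube of radius `< 3·10⁻⁸` around the kernel's Newton-in-the-program approximant), the radial derivative there is
  positive, and THE POLAR `(6.35)` INTEGRAL satisfies **`2·totLo ≤ ∫₀^{2π} ρ(θ)/((X_a + ρ(θ) cos θ)·D_r(θ, ρ(θ))) dθ ≤ 2·totHi`**, hence
  **`2.247991161 ≤ qHalfOverF ≤ 2.247991192`** where `qHalfOverF := (1/2π)·∫₀^{2π} …` is Freidberg's `q/F` of that surface in the polar form of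
  `Models/FluxSurfacePolarRay.lean` (#88).  The lower half of the loop is the mirror image: `∫_π^{2π} = ∫_0^π` (`U(X, −Y) = U(X, Y)`, `UN_neg`).
  Width `3·10⁻⁸` (the ITER-like ★ #117 had `2.6·10⁻⁷`: degree-12 `inv` candidates and degree 14 at the two end panels).
* VALIDATED (never used in a proof): float replay of the same stack machine + direct Newton / trapezoid rule (gridfusion-model-5 g8,
  `pub/gridfusion/models/gen-model-5/g8/`): `q/F(ψ_N = 1/2) ≈ 2.2479911766`, inside the kernel bracket.  No lineage-1 (`bench/F2-CF-NSTX-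
  alpha0-lineage1.json`) value exists at `ψ_N = 1/2` (that file validates `ψ_N ∈ {1, 1/4}` only).
* MODELLED: analytic Cerfon–Freidberg family (ideal MHD, Solov'ev profiles `A = 0`, fixed analytic boundary), NSTX-like triple; `q` of a MODEL
  flux surface — nothing about a device, a discharge, or stability.
PIPELINE (all in the tree; NSTX-like twins of the ITER-like chain, instance-independent pieces reused BY NAME): `…NstxLikeAxisTight` (tight box)
→ `…NstxLikeQHalfDefs` (programs) → `…Panels1–9` (32 Taylor-model panel certificates, `decide +kernel`) → `…Sound` (their meaning) → `…Ray`
(calculus) → `…Boxes/A/B` (296 interval boxes) → `…Link/Panel` (tube, unique crossing, per-panel bracket) → `…Data` (32 brackets) → here: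
the panel sum (`PolarRay.sum_panel_bounds`), the mirror symmetry, the headline.  Typer/prover: gridfusion-model-5 (g8), 2026-08-27.
Citations: Freidberg 2014 §6.3.5 (6.35), §6.6.1 (6.153) [Freidberg2014]; Cerfon–Freidberg 2010 §IV [CerfonFreidberg2010];
Mahboubi–Melquiond–Sibut-Pinote 2016 [MahboubiMelquiondSibutpinote2016].
-/

noncomputable section

open Set MeasureTheory intervalIntegral
open Literature.Analysis.ValidatedNumerics Literature.Analysis.ValidatedNumerics.PolyMP
open Literature.MathematicalPhysics.MHD Literature.MathematicalPhysics.MHD.CerfonFreidberg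
open Summit.Ventures.FusionMHD.Models.PolarRay

set_option autoImplicit false

namespace Summit.Ventures.FusionMHD.Models.CFNstxLike.QHalf

/-! ## §3 The sum over `[0, π]` (NSTX-like) -/

/-- `aθ 0 = 0`, `aθ 32 = π`. -/
theorem aθ_ends : CFNstxLike.QHalf.aθ 0 = 0 ∧ aθ 32 = Real.pi := by
  constructor <;> norm_num [aθ, panelLeft, CFIterLike.QHalf.hw]

/-- The certified lower sum `Σ Lo_j` (NSTX-like). -/
def totLo : ℚ := (88278406474371 / 12500000000000)
/-- The certified upper sum `Σ Hi_j` (NSTX-like). -/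
def totHi : ℚ := (706227261327957 / 100000000000000)

/-- The sums of the NSTX-like link bounds are `totLo`, `totHi`. -/
theorem sums_eq : (∑ k ∈ Finset.range 32, (((CFNstxLike.QHalf.lP k).Lo : ℚ) : ℝ)) = ((totLo : ℚ) : ℝ)
    ∧ (∑ k ∈ Finset.range 32, (((lP k).Hi : ℚ) : ℝ)) = ((totHi : ℚ) : ℝ) := by
  constructor
  · rw [show (∑ k ∈ Finset.range 32, (((lP k).Lo : ℚ) : ℝ)) = ((∑ k ∈ Finset.range 32, (lP k).Lo : ℚ) : ℝ) by push_cast; rfl]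
    exact_mod_cast (by decide +kernel : (∑ k ∈ Finset.range 32, (lP k).Lo) = totLo)
  · rw [show (∑ k ∈ Finset.range 32, (((lP k).Hi : ℚ) : ℝ)) = ((∑ k ∈ Finset.range 32, (lP k).Hi : ℚ) : ℝ) by push_cast; rfl]
    exact_mod_cast (by decide +kernel : (∑ k ∈ Finset.range 32, (lP k).Hi) = totHi)

/-- **THE UPPER HALF (NSTX-like)**: `totLo ≤ ∫₀^π Pq ≤ totHi`, and `Pq` is integrable on `[0, π]`. -/
theorem half_bounds : ((CFNstxLike.QHalf.totLo : ℚ) : ℝ) ≤ ∫ θ in (0 : ℝ)..Real.pi, Pq θ ∧ ∫ θ in (0 : ℝ)..Real.pi, Pq θ ≤ ((totHi : ℚ) : ℝ)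
    ∧ IntervalIntegrable Pq volume 0 Real.pi := by
  have hint : ∀ k < 32, IntervalIntegrable Pq volume (aθ k) (aθ (k + 1)) := by
    intro k hk
    interval_cases k
    · exact pb0.2.2
    · exact pb1.2.2
    · exact pb2.2.2
    · exact pb3.2.2
    · exact pb4.2.2
    · exact pb5.2.2
    · exact pb6.2.2
    · exact pb7.2.2
    · exact pb8.2.2
    · exact pb9.2.2
    · exact pb10.2.2
    · exact pb11.2.2
    · exact pb12.2.2
    · exact pb13.2.2
    · exact pb14.2.2
    · exact pb15.2.2
    · exact pb16.2.2
    · exact pb17.2.2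
    · exact pb18.2.2
    · exact pb19.2.2
    · exact pb20.2.2
    · exact pb21.2.2
    · exact pb22.2.2
    · exact pb23.2.2
    · exact pb24.2.2
    · exact pb25.2.2
    · exact pb26.2.2
    · exact pb27.2.2
    · exact pb28.2.2
    · exact pb29.2.2
    · exact pb30.2.2
    · exact pb31.2.2
  have hlo : ∀ k < 32, (((lP k).Lo : ℚ) : ℝ) ≤ ∫ θ in aθ k..aθ (k + 1), Pq θ := by
    intro k hk
    interval_cases k
    · exact pb0.1
    · exact pb1.1
    · exact pb2.1
    · exact pb3.1
    · exact pb4.1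
    · exact pb5.1
    · exact pb6.1
    · exact pb7.1
    · exact pb8.1
    · exact pb9.1
    · exact pb10.1
    · exact pb11.1
    · exact pb12.1
    · exact pb13.1
    · exact pb14.1
    · exact pb15.1
    · exact pb16.1
    · exact pb17.1
    · exact pb18.1
    · exact pb19.1
    · exact pb20.1
    · exact pb21.1
    · exact pb22.1
    · exact pb23.1
    · exact pb24.1
    · exact pb25.1
    · exact pb26.1
    · exact pb27.1
    · exact pb28.1
    · exact pb29.1
    · exact pb30.1
    · exact pb31.1
  have hhi : ∀ k < 32, ∫ θ in aθ k..aθ (k + 1), Pq θ ≤ (((lP k).Hi : ℚ) : ℝ) := by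
    intro k hk
    interval_cases k
    · exact pb0.2.1
    · exact pb1.2.1
    · exact pb2.2.1
    · exact pb3.2.1
    · exact pb4.2.1
    · exact pb5.2.1
    · exact pb6.2.1
    · exact pb7.2.1
    · exact pb8.2.1
    · exact pb9.2.1
    · exact pb10.2.1
    · exact pb11.2.1
    · exact pb12.2.1
    · exact pb13.2.1
    · exact pb14.2.1
    · exact pb15.2.1
    · exact pb16.2.1
    · exact pb17.2.1
    · exact pb18.2.1
    · exact pb19.2.1
    · exact pb20.2.1
    · exact pb21.2.1
    · exact pb22.2.1
    · exact pb23.2.1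
    · exact pb24.2.1
    · exact pb25.2.1
    · exact pb26.2.1
    · exact pb27.2.1
    · exact pb28.2.1
    · exact pb29.2.1
    · exact pb30.2.1
    · exact pb31.2.1
  have hs := sum_panel_bounds (N := 32) (t := aθ) (f := Pq) hint hlo hhi
  rw [sums_eq.1, sums_eq.2, aθ_ends.1, aθ_ends.2] at hs
  have hI := IntervalIntegrable.trans_iterate (a := aθ) (n := 32) hint
  rw [aθ_ends.1, aθ_ends.2] at hI
  exact ⟨hs.1, hs.2, hI⟩

/-! ## §4 The mirror symmetry `θ ↦ −θ` and the lower half (NSTX-like) -/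

/-- **Up–down symmetry of the NSTX-like flux of record:** `U(X, −Y) = U(X, Y)` (the `α = 0` family is even in `Y`). -/
theorem UN_neg (X Y : ℝ) : CFNstxLike.U X (-Y) = U X Y := by
  show cfSolution 0 coeff X (-Y) = cfSolution 0 coeff X Y
  have h := cfSolution_zero_vertical coeff X
  have h1 : cfSolution 0 coeff X (-Y)
      = vertG₀ coeff X + vertG₂ coeff X * (-Y) ^ 2 + vertG₄ coeff X * (-Y) ^ 4 + vertG₆ coeff X * (-Y) ^ 6 := congrFun h (-Y)
  have h2 : cfSolution 0 coeff X Y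
      = vertG₀ coeff X + vertG₂ coeff X * Y ^ 2 + vertG₄ coeff X * Y ^ 4 + vertG₆ coeff X * Y ^ 6 := congrFun h Y
  rw [h1, h2]
  ring

/-- The NSTX-like ray profile is even in `θ` (`U(X, −Y) = U(X, Y)`). -/
theorem rayProfile_neg (θ s : ℝ) : rayProfile CFNstxLike.U Xa 0 (-θ) s = rayProfile U Xa 0 θ s := by
  unfold rayProfile
  rw [Real.cos_neg, Real.sin_neg, show (0 : ℝ) + s * -Real.sin θ = -(0 + s * Real.sin θ) by ring]
  exact UN_neg _ _

/-- The NSTX-like glued ray radius is even in `θ`. -/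
theorem ρ_neg (θ : ℝ) : CFNstxLike.QHalf.ρ (-θ) = ρ θ := by
  unfold ρ rayRadius rootSet
  simp_rw [rayProfile_neg]

/-- `U_X` closed form is even in `Y` (restated for the NSTX-like coefficient vector). -/
theorem UXc_negY_coeff (X Y : ℝ) : CFIterLike.QHalf.UXc CFNstxLike.coeff X (-Y) = CFIterLike.QHalf.UXc coeff X Y := by unfold CFIterLike.QHalf.UXc; ring
/-- `U_Y` closed form is odd in `Y` (restated for the NSTX-like coefficient vector). -/
theorem UYc_negY_coeff (X Y : ℝ) : CFIterLike.QHalf.UYc CFNstxLike.coeff X (-Y) = -CFIterLike.QHalf.UYc coeff X Y := by unfold CFIterLike.QHalf.UYc; ring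

/-- The NSTX-like radial-derivative field is even in `θ`. -/
theorem Dfield_neg (θ s : ℝ) : CFNstxLike.QHalf.Dfield (-θ) s = Dfield θ s := by
  unfold Dfield CFIterLike.QHalf.Drc
  rw [Real.cos_neg, Real.sin_neg, show s * -Real.sin θ = -(s * Real.sin θ) by ring, UXc_negY_coeff, UYc_negY_coeff]
  ring

/-- The NSTX-like polar integrand is even in `θ`. -/
theorem Pq_neg (θ : ℝ) : CFNstxLike.QHalf.Pq (-θ) = Pq θ := by
  unfold Pq polarIntegrand
  rw [show rayRadius U Xa 0 u₀ (-θ) = ρ (-θ) from rfl, ρ_neg, Dfield_neg, Real.cos_neg]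
  rfl

/-- The NSTX-like radial-derivative field is `2π`-periodic in `θ`. -/
theorem Dfield_periodic (θ s : ℝ) : CFNstxLike.QHalf.Dfield (θ + 2 * Real.pi) s = Dfield θ s := by
  unfold Dfield CFIterLike.QHalf.Drc
  rw [Real.cos_add_two_pi, Real.sin_add_two_pi]

/-- The NSTX-like polar integrand is `2π`-periodic. -/
theorem Pq_periodic (θ : ℝ) : CFNstxLike.QHalf.Pq (θ + 2 * Real.pi) = Pq θ := by
  unfold Pq polarIntegrand
  rw [show rayRadius U Xa 0 u₀ (θ + 2 * Real.pi) = rayRadius U Xa 0 u₀ θ from periodic_rayRadius U Xa 0 u₀ θ, Dfield_periodic,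
    Real.cos_add_two_pi]

/-- **THE LOWER HALF IS THE MIRROR IMAGE (NSTX-like)**: `∫_π^{2π} Pq = ∫_0^π Pq`, with integrability. -/
theorem lower_half : ∫ θ in Real.pi..(2 * Real.pi), CFNstxLike.QHalf.Pq θ = ∫ θ in (0 : ℝ)..Real.pi, Pq θ
    ∧ IntervalIntegrable Pq volume Real.pi (2 * Real.pi) := by
  have hrefl : ∀ x : ℝ, Pq (2 * Real.pi - x) = Pq x := by
    intro x; rw [show 2 * Real.pi - x = -x + 2 * Real.pi by ring, Pq_periodic, Pq_neg]
  constructor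
  · have h := intervalIntegral.integral_comp_sub_left Pq (2 * Real.pi) (a := 0) (b := Real.pi)
    simp only [sub_zero, show 2 * Real.pi - Real.pi = Real.pi by ring] at h
    rw [← h]
    exact intervalIntegral.integral_congr fun x _ => hrefl x
  · have h := (half_bounds.2.2).comp_sub_left (2 * Real.pi)
    simp only [sub_zero, show 2 * Real.pi - Real.pi = Real.pi by ring] at h
    have hfun : (fun x => Pq (2 * Real.pi - x)) = Pq := funext hrefl
    rw [hfun] at h
    exact h.symm

/-! ## §5 ★ The certified NSTX-like `q(ψ_N = 1/2)/F` -/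

/-- **Freidberg's `q/F` of the NSTX-like surface `ψ_N = 1/2` in the polar `(6.35)` form**: `(1/2π)·∫₀^{2π} ρ/((X_a + ρ cos θ)·D_r(θ, ρ)) dθ`. -/
def qHalfOverF : ℝ := 1 / (2 * Real.pi) * ∫ θ in (0 : ℝ)..(2 * Real.pi), Pq θ

/-- **THE FULL-LOOP BRACKET (NSTX-like)**: `2·totLo ≤ ∫₀^{2π} Pq ≤ 2·totHi`. -/
theorem full_bounds : 2 * ((CFNstxLike.QHalf.totLo : ℚ) : ℝ) ≤ ∫ θ in (0 : ℝ)..(2 * Real.pi), Pq θ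
    ∧ ∫ θ in (0 : ℝ)..(2 * Real.pi), Pq θ ≤ 2 * ((totHi : ℚ) : ℝ) := by
  obtain ⟨h1, h2, hI⟩ := half_bounds
  obtain ⟨h3, hI2⟩ := lower_half
  rw [← intervalIntegral.integral_add_adjacent_intervals hI hI2, h3]
  constructor <;> linarith

/-- **★ THE HEADLINE (NSTX-like): `2.247991161 ≤ q(ψ_N = 1/2)/F ≤ 2.247991192`** for THE Cerfon–Freidberg NSTX-like MODEL flux (polar `(6.35)`
form; float replay 2.2479911766; the width `3·10⁻⁸` is the tube envelope + the kernel's Taylor-model integral enclosure + `π`'s 20-digit box). -/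
theorem qHalfOverF_bounds : ((2247991161 / 1000000000) : ℝ) ≤ CFNstxLike.QHalf.qHalfOverF ∧ qHalfOverF ≤ ((280998899 / 125000000) : ℝ) := by
  obtain ⟨h1, h2⟩ := full_bounds
  have hpi1 := Real.pi_gt_d20; have hpi2 := Real.pi_lt_d20
  have hpi : 0 < Real.pi := Real.pi_pos
  norm_num [totLo, totHi] at h1 h2
  have e : qHalfOverF = (∫ θ in (0 : ℝ)..(2 * Real.pi), Pq θ) / (2 * Real.pi) := by
    unfold qHalfOverF; rw [one_div, inv_mul_eq_div]
  rw [e]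
  constructor
  · rw [le_div_iff₀ (by positivity)]; nlinarith [h1, hpi2]
  · rw [div_le_iff₀ (by positivity)]; nlinarith [h2, hpi1]

end Summit.Ventures.FusionMHD.Models.CFNstxLike.QHalf

end
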